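import Mathlib
import HarnessLib
import Summits.HubbardSuperconductivity.HubbardSuperconductivity.Theorems.KLProgrammeKLRegimeEngineTowerLevLawOfInputsScaledDisc
import Summits.HubbardSuperconductivity.HubbardSuperconductivity.Theorems.KLProgrammeKLRegimeEngineTowerLevNumerics

/-!
# Route `KLProgramme` — crux K3 ENGINE (stmt-HubbardSuperconductivity-20437 `KLRegimeEngineV17F2`), stub (b) v2, THE LEVELS PACKAGE (ℓ):
# THE LEVELLED TOWER LAW WITH ITS NUMERICS CLOSED — from the step, the imports, the cell, the BLOCKING row, two AMPLITUDE rows in `B`, and `λ ≤ λ₀` / the two doors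
# (cell gate-hubbard-kl, seat hubbard-kl-k3c3-p2 g14, «(I5)-LEV»; composition of `klTowerBLev_le_law_of_inputs_scaled_disc` (…LevLawOfInputsScaledDisc) with
#  `towerLevNumerics_rows` / `towerLevNumerics_side_of_lam_le` / `towerLevNumerics_side_of_doors` (…LevNumerics); E1's (I5)/(I7)-LEV by the substitute precedent)

WHAT.  `klTowerBLev_le_law_of_inputs_scaled_disc` = the kit (T3-P) at the five level tracks with the UV rows discharged, modulo: the step `hstep` (E1 (I1), k3c2-p3's LINK),
the imports `ι₁ ι₂` (E1 (I4)), the located cell `X` («(I2)-F1-HMU»), and — (I5) — five floors on `(A′, Q′, ι₃)` plus the kit's eight numerics.  Here the (I5) part is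
CLOSED: the constants are the explicit choices of …LevNumerics (equational binders `ρ Q′ Q ĉ Y A A′ ι₃`, instantiate with `rfl`),

  `ρ = max 4 (2τψ)`, `Q′ = Z·(Qe.CE/ε_x²) + 1`, `Q = ρ·Q′`, `ĉ = 1 + (C₁/C₂)·8^{d−1}`, `Y = ι₂/(2Q′) + W·Z³·X/(4Q′²) + W·27⁵·(ε_x/B²)·ĉ·Q′/2`,
  `A = 2Y(1−(√2^d)⁻¹)/(W·27⁵·ĉ·Q′)`, `A′ = W·27⁵·(ε_x/B²)·ĉ + 2Y/Q′`, `ι₃ = W·Z³·X + A′Q′³`   (`ε_x = imagTimeWeight β M`),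

and what remains NUMERICAL is: the BLOCKING row `max 1 Z · C₂² · max 4 (2τψ) ≤ 2^{d−1}` (choice of `d`), the AMPLITUDE rows `8·Φ·τ·Y ≤ 1` and
`128·e·ψ³·τ⁴·Φ·(W·27⁵·ĉ)·Y ≤ (1−(√2^d)⁻¹)·ρ³` (choice of `B`: `Y = O(1/B)` at `λ = B·ε`), and the coupling smallness — either `λ ≤ λ₀` (the explicit seven-entry
`min`-chain of …EngineTowerNumerics at the chosen constants; `klTowerBLev_le_law_lev_of_rows`) or, in the KL regime at `λ := B·epsCoupling P U j`, the U-door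
`U ≤ λ₀/(2·B·Klam + 1)` and the c-door `cc ≤ λ₀·log 4/(2·B·Klam + 1)` (`klTowerBLev_le_law_lev_of_doors`).
⊢ `∀ k ≤ K_b, ∀ t, ∀ 3 ≤ p ≤ D, klTowerBLev … d t k p ≤ A·λ^{p−1}·Q^p`.
Composition of landed theorems; nothing about the model is asserted beyond them and the named inputs; nothing asserts (ℓ), any stub, K3 or superconductivity.
References: BGM 2006 §2.8 (2.83), (2.93)–(2.98) [cite: BenfattoGiulianiMastropietro2006].
-/

noncomputable section

namespace Summit.HubbardSuperconductivity.HubbardSuperconductivity.Theorems.EngineV8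

set_option linter.dupNamespace false -- summit = problem name (single-conjunct summit), D-0017

open Classical
open Real Finset Literature.MathematicalPhysics.QuantumLattice Literature.Probability.LatticeModels GrassmannAlgebra
open Literature.MathematicalPhysics.QuantumLattice.FermiRG
open Summit.HubbardSuperconductivity.HubbardSuperconductivity.Theorems.KLProgrammeLegKernels
open Summit.HubbardSuperconductivity.HubbardSuperconductivity.Theorems.KLRegimeSplit
open Summit.HubbardSuperconductivity.HubbardSuperconductivity.Theorems.KLRegimeWick
open Summit.HubbardSuperconductivity.HubbardSuperconductivity.Theorems.TorusFourierL2
open Summit.HubbardSuperconductivity.HubbardSuperconductivity.Theorems.DispersionFlow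

/-- `epsCoupling P U 0 ≤ epsCoupling P U j` (`Klam ≥ 0`): the coupling parameter is monotone in the scale index. -/
theorem epsCoupling_zero_le_epsCoupling {P : SplitConsts} (hK : 0 ≤ P.Klam) (U : ℝ) (j : ℕ) : epsCoupling P U 0 ≤ epsCoupling P U j := by
  unfold epsCoupling
  refine mul_le_mul_of_nonneg_left ?_ hK
  have : 0 ≤ U ^ 2 * (j : ℝ) := by positivity
  simp only [Nat.cast_zero, mul_zero, add_zero]
  linarith

/-- **THE LEVELLED TOWER LAW, NUMERICS CLOSED, `λ ≤ λ₀` FORM** (see the module docstring; the equational binders are the explicit (I5)-LEV choices, `rfl` at the call).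
[cite: BenfattoGiulianiMastropietro2006, §2.8 (2.83), (2.93)-(2.98)] -/
theorem klTowerBLev_le_law_lev_of_rows :
    ∃ C₁ C₂ : ℝ, 0 < C₁ ∧ 0 < C₂ ∧ ∀ R : RenConsts, R.WF2 → ∃ c₃' : ℝ, 0 < c₃' ∧ ∃ U₀' : ℝ, 0 < U₀' ∧
      ∀ (P : SplitConsts) (c : ℝ), P.WF → 0 < c → c ≤ klEngC₃6 P R → c ≤ c₃' →
      ∀ μ ∈ klWindowC, ∀ U : ℝ, 0 < U → U ≤ klEngU₀9 P R c → U ≤ U₀' → ∀ β : ℝ, klBetaMin ≤ β → β ≤ Real.exp (c / U ^ 2) →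
      ∀ K : TrigPolyC4v, FrameOK R U (nScales β) μ K → ∀ (L M : ℕ) [NeZero L] [NeZero M],
      klEngL₃ β U ≤ L → klEngM₃ β U L ≤ M → ∀ d Kb D : ℕ, 2 ≤ d → d * Kb - 1 ≤ nScales β + 1 → 3 ≤ D →
      ∀ (Qe : EngConsts), 0 ≤ Qe.CE → KernelNormsLevels L M P Qe β U μ K 0 →
      ∀ (lam B W Z σ Φ ψ τ ι₁ ι₂ X : ℝ), 1 ≤ B → B * epsCoupling P U 0 ≤ lam → 0 < W → 0 < Z →
        0 ≤ σ → 0 ≤ Φ → 0 ≤ ψ → 0 < τ → 0 ≤ ι₁ → 0 ≤ ι₂ → 0 ≤ X →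
      -- the explicit (I5)-LEV choices (equational binders)
      ∀ (ρ Q' Q ĉ Y A A' ι₃ : ℝ), ρ = max 4 (2 * τ * ψ) → Q' = Z * (Qe.CE / imagTimeWeight β M ^ 2) + 1 → Q = ρ * Q' →
        ĉ = 1 + C₁ / C₂ * (8 : ℝ) ^ (d - 1) →
        Y = ι₂ / (2 * Q') + W * Z ^ 3 * X / (4 * Q' ^ 2) + W * ((27 : ℝ) ^ 5 * (imagTimeWeight β M / B ^ 2)) * ĉ * Q' / 2 →
        A = 2 * Y * (1 - (Real.sqrt 2 ^ d)⁻¹) / (W * (27 : ℝ) ^ 5 * ĉ * Q') →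
        A' = W * ((27 : ℝ) ^ 5 * (imagTimeWeight β M / B ^ 2)) * ĉ + 2 * Y / Q' → ι₃ = W * Z ^ 3 * X + A' * Q' ^ 3 →
      -- the BLOCKING row and the two AMPLITUDE rows
      max 1 Z * C₂ ^ 2 * max 4 (2 * τ * ψ) ≤ (2 : ℝ) ^ (d - 1) → 8 * Φ * τ * Y ≤ 1 →
        128 * exp 1 * ψ ^ 3 * τ ^ 4 * Φ * (W * (27 : ℝ) ^ 5 * ĉ) * Y ≤ (1 - (Real.sqrt 2 ^ d)⁻¹) * ρ ^ 3 →
      -- the imports (E1 (I4))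
      (∀ k < Kb, W * Z ^ 1 * klTowerMuLev L M β U μ K d k 1 ≤ ι₁ * lam) → (∀ k < Kb, W * Z ^ 2 * klTowerMuLev L M β U μ K d k 2 ≤ ι₂ * lam) →
      -- the located six-leg cell «(I2)-F1-HMU»
      (∀ k, 1 ≤ k → k < Kb → klTowerMuLevAt L M β U μ K d 0 k 3 ≤ X * lam ^ 2) →
      -- the step (k3c2-p3's graded rows at `μ := W·Z^m·klTowerMuLev`, E1 (I1))
      (∀ t : Fin 5, ∀ k < Kb, ∀ N : ℕ, 2 ≤ N → ∀ p, 3 ≤ p → p ≤ D →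
        Φ * towerV D τ (fun m => W * Z ^ m * klTowerMuLev L M β U μ K d k m) < 1 →
        klTowerBLev L M β U μ K d t (k + 1) p ≤
          towerFO D σ (fun m => W * Z ^ m * klTowerMuLev L M β U μ K d k m) p +
            ∑ n ∈ Icc 2 N, exp 1 * Φ ^ (n - 1) * ψ ^ p * towerS D τ (fun m => W * Z ^ m * klTowerMuLev L M β U μ K d k m) n p +
            ψ ^ p * exp 1 * towerV D τ (fun m => W * Z ^ m * klTowerMuLev L M β U μ K d k m) *
              (Φ * towerV D τ (fun m => W * Z ^ m * klTowerMuLev L M β U μ K d k m)) ^ N /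
              (1 - Φ * towerV D τ (fun m => W * Z ^ m * klTowerMuLev L M β U μ K d k m))) →
      -- the coupling smallness `λ ≤ λ₀`
      lam ≤ min 1 (min (1 / (8 * σ * Q' + 1)) (min (1 / (2 * exp 1 * τ * Q' + 1)) (min (1 / (4 * Φ * τ * ι₁ + 1))
        (min (1 / (2 * (Φ * (exp 1 * τ * ι₁ + (exp 1 * τ) ^ 2 * ι₂ + (exp 1 * τ) ^ 3 * ι₃ + A' * (exp 1 * τ * Q') ^ 2 / 2)) + 1))
          (min (A * Q ^ 3 / (16 * σ * Q' * A' * (4 * Q') ^ 3 + A * Q ^ 3))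
            (A * Q ^ 3 / (16 * exp 1 * ψ * (2 * τ * ψ * Q') ^ 2 * Φ * τ ^ 2 * ι₁ ^ 2 + A * Q ^ 3))))))) →
      ∀ k ≤ Kb, ∀ (t : Fin 5) (p : ℕ), 3 ≤ p → p ≤ D → klTowerBLev L M β U μ K d t k p ≤ A * lam ^ (p - 1) * Q ^ p := by
  obtain ⟨C₁, C₂, hC₁, hC₂, h⟩ := klTowerBLev_le_law_of_inputs_scaled_disc
  refine ⟨C₁, C₂, hC₁, hC₂, fun R hR2 => ?_⟩
  obtain ⟨c₃, hc₃, U₀, hU₀, h'⟩ := h R hR2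
  refine ⟨c₃, hc₃, U₀, hU₀, ?_⟩
  intro P c hP hc hc6 hc₃' μ hμ U hU hU9 hU₀' β hβmin hβc K hK L M _ _ hL3 hM3 d Kb D hd hKbN hD Qe hCE h0 lam B W Z σ Φ ψ τ ι₁ ι₂ X hB hεl hW hZ
    hσ hΦ hψ hτ hι₁ hι₂ hX ρ Q' Q ĉ Y A A' ι₃ hρ hQ' hQ hĉ hY hA hA' hι₃ hblock amp1 amp2 himp₁ himp₂ hcell hstep hle
  have hx : 0 < imagTimeWeight β M := by
    unfold imagTimeWeight
    have hβ : 0 < β := KLRegimeSplit.pos_of_klBetaMin_le hβmin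
    have : (0 : ℝ) < M := Nat.cast_pos.2 (Nat.pos_of_ne_zero (NeZero.ne M))
    positivity
  have hK0 : 0 ≤ P.Klam := le_trans zero_le_one hP.1
  have hε0 : 0 ≤ epsCoupling P U 0 := by unfold epsCoupling; positivity
  have hlam : 0 ≤ lam := le_trans (by positivity) hεl
  obtain ⟨⟨hQ'0, hQ0, hA0, _, _, _⟩, ⟨hF1, hF2, hF3, hF4, hF6, hF7⟩, ⟨hu₁, hu₂⟩, _, _⟩ :=
    towerLevNumerics_rows hW hZ hC₁ hC₂ hd hx hCE hB hι₂ hX hρ hQ' hQ hĉ hY hA hA' hι₃ hblock amp1 amp2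
  obtain ⟨hx₁, hx₂, hx₃, hy, hθ, hclose⟩ :=
    towerLevNumerics_side_of_lam_le hσ hΦ hψ hτ hW hZ hC₁ hC₂ hd hx hCE hB hι₁ hι₂ hX hρ hQ' hQ hĉ hY hA hA' hι₃ hblock amp1 amp2 hlam hle
  exact h' P c hP hc hc6 hc₃' μ hμ U hU hU9 hU₀' β hβmin hβc K hK L M hL3 hM3 d Kb D hd hKbN hD Qe hCE h0 A lam Q B hA0.le hQ0 hB hεl W Z A' Q'
    hW hZ hF1 hF2 hF3 hF4 hQ'0 σ Φ ψ τ ι₁ ι₂ ι₃ X hσ hΦ hψ hτ hF6 hF7 himp₁ himp₂ hcell hstep hx₁ hx₂ hx₃ hy hθ hu₁ hu₂ hclose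

/-- **THE LEVELLED TOWER LAW, NUMERICS CLOSED, DOORS FORM** (KL regime): at `λ := B·epsCoupling P U j` (`j ≤ n`, `IsKLRegime U cc (−n)`), the coupling smallness is the
U-door `U ≤ λ₀/(2·B·Klam + 1)` and the c-door `cc ≤ λ₀·log 4/(2·B·Klam + 1)`; everything else as in `klTowerBLev_le_law_lev_of_rows`.
[cite: BenfattoGiulianiMastropietro2006, §2.8 (2.83), (2.93)-(2.98)] -/
theorem klTowerBLev_le_law_lev_of_doors :
    ∃ C₁ C₂ : ℝ, 0 < C₁ ∧ 0 < C₂ ∧ ∀ R : RenConsts, R.WF2 → ∃ c₃' : ℝ, 0 < c₃' ∧ ∃ U₀' : ℝ, 0 < U₀' ∧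
      ∀ (P : SplitConsts) (c : ℝ), P.WF → 0 < c → c ≤ klEngC₃6 P R → c ≤ c₃' →
      ∀ μ ∈ klWindowC, ∀ U : ℝ, 0 < U → U ≤ klEngU₀9 P R c → U ≤ U₀' → ∀ β : ℝ, klBetaMin ≤ β → β ≤ Real.exp (c / U ^ 2) →
      ∀ K : TrigPolyC4v, FrameOK R U (nScales β) μ K → ∀ (L M : ℕ) [NeZero L] [NeZero M],
      klEngL₃ β U ≤ L → klEngM₃ β U L ≤ M → ∀ d Kb D : ℕ, 2 ≤ d → d * Kb - 1 ≤ nScales β + 1 → 3 ≤ D →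
      ∀ (Qe : EngConsts), 0 ≤ Qe.CE → KernelNormsLevels L M P Qe β U μ K 0 →
      ∀ (cc : ℝ) (n j : ℕ), IsKLRegime U cc (-(n : ℤ)) → j ≤ n →
      ∀ (B W Z σ Φ ψ τ ι₁ ι₂ X : ℝ), 1 ≤ B → 0 < W → 0 < Z →
        0 ≤ σ → 0 ≤ Φ → 0 ≤ ψ → 0 < τ → 0 ≤ ι₁ → 0 ≤ ι₂ → 0 ≤ X →
      -- the explicit (I5)-LEV choices (equational binders)
      ∀ (ρ Q' Q ĉ Y A A' ι₃ : ℝ), ρ = max 4 (2 * τ * ψ) → Q' = Z * (Qe.CE / imagTimeWeight β M ^ 2) + 1 → Q = ρ * Q' →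
        ĉ = 1 + C₁ / C₂ * (8 : ℝ) ^ (d - 1) →
        Y = ι₂ / (2 * Q') + W * Z ^ 3 * X / (4 * Q' ^ 2) + W * ((27 : ℝ) ^ 5 * (imagTimeWeight β M / B ^ 2)) * ĉ * Q' / 2 →
        A = 2 * Y * (1 - (Real.sqrt 2 ^ d)⁻¹) / (W * (27 : ℝ) ^ 5 * ĉ * Q') →
        A' = W * ((27 : ℝ) ^ 5 * (imagTimeWeight β M / B ^ 2)) * ĉ + 2 * Y / Q' → ι₃ = W * Z ^ 3 * X + A' * Q' ^ 3 →
      -- the BLOCKING row and the two AMPLITUDE rows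
      max 1 Z * C₂ ^ 2 * max 4 (2 * τ * ψ) ≤ (2 : ℝ) ^ (d - 1) → 8 * Φ * τ * Y ≤ 1 →
        128 * exp 1 * ψ ^ 3 * τ ^ 4 * Φ * (W * (27 : ℝ) ^ 5 * ĉ) * Y ≤ (1 - (Real.sqrt 2 ^ d)⁻¹) * ρ ^ 3 →
      -- the imports (E1 (I4)) at `λ = B·ε_j`
      (∀ k < Kb, W * Z ^ 1 * klTowerMuLev L M β U μ K d k 1 ≤ ι₁ * (B * epsCoupling P U j)) →
      (∀ k < Kb, W * Z ^ 2 * klTowerMuLev L M β U μ K d k 2 ≤ ι₂ * (B * epsCoupling P U j)) →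
      -- the located six-leg cell «(I2)-F1-HMU»
      (∀ k, 1 ≤ k → k < Kb → klTowerMuLevAt L M β U μ K d 0 k 3 ≤ X * (B * epsCoupling P U j) ^ 2) →
      -- the step (E1 (I1))
      (∀ t : Fin 5, ∀ k < Kb, ∀ N : ℕ, 2 ≤ N → ∀ p, 3 ≤ p → p ≤ D →
        Φ * towerV D τ (fun m => W * Z ^ m * klTowerMuLev L M β U μ K d k m) < 1 →
        klTowerBLev L M β U μ K d t (k + 1) p ≤
          towerFO D σ (fun m => W * Z ^ m * klTowerMuLev L M β U μ K d k m) p +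
            ∑ n ∈ Icc 2 N, exp 1 * Φ ^ (n - 1) * ψ ^ p * towerS D τ (fun m => W * Z ^ m * klTowerMuLev L M β U μ K d k m) n p +
            ψ ^ p * exp 1 * towerV D τ (fun m => W * Z ^ m * klTowerMuLev L M β U μ K d k m) *
              (Φ * towerV D τ (fun m => W * Z ^ m * klTowerMuLev L M β U μ K d k m)) ^ N /
              (1 - Φ * towerV D τ (fun m => W * Z ^ m * klTowerMuLev L M β U μ K d k m))) →
      -- the two doors
      U ≤ min 1 (min (1 / (8 * σ * Q' + 1)) (min (1 / (2 * exp 1 * τ * Q' + 1)) (min (1 / (4 * Φ * τ * ι₁ + 1))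
        (min (1 / (2 * (Φ * (exp 1 * τ * ι₁ + (exp 1 * τ) ^ 2 * ι₂ + (exp 1 * τ) ^ 3 * ι₃ + A' * (exp 1 * τ * Q') ^ 2 / 2)) + 1))
          (min (A * Q ^ 3 / (16 * σ * Q' * A' * (4 * Q') ^ 3 + A * Q ^ 3))
            (A * Q ^ 3 / (16 * exp 1 * ψ * (2 * τ * ψ * Q') ^ 2 * Φ * τ ^ 2 * ι₁ ^ 2 + A * Q ^ 3))))))) / (2 * B * P.Klam + 1) →
      cc ≤ min 1 (min (1 / (8 * σ * Q' + 1)) (min (1 / (2 * exp 1 * τ * Q' + 1)) (min (1 / (4 * Φ * τ * ι₁ + 1))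
        (min (1 / (2 * (Φ * (exp 1 * τ * ι₁ + (exp 1 * τ) ^ 2 * ι₂ + (exp 1 * τ) ^ 3 * ι₃ + A' * (exp 1 * τ * Q') ^ 2 / 2)) + 1))
          (min (A * Q ^ 3 / (16 * σ * Q' * A' * (4 * Q') ^ 3 + A * Q ^ 3))
            (A * Q ^ 3 / (16 * exp 1 * ψ * (2 * τ * ψ * Q') ^ 2 * Φ * τ ^ 2 * ι₁ ^ 2 + A * Q ^ 3))))))) * Real.log 4 / (2 * B * P.Klam + 1) →
      ∀ k ≤ Kb, ∀ (t : Fin 5) (p : ℕ), 3 ≤ p → p ≤ D →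
        klTowerBLev L M β U μ K d t k p ≤ A * (B * epsCoupling P U j) ^ (p - 1) * Q ^ p := by
  obtain ⟨C₁, C₂, hC₁, hC₂, h⟩ := klTowerBLev_le_law_of_inputs_scaled_disc
  refine ⟨C₁, C₂, hC₁, hC₂, fun R hR2 => ?_⟩
  obtain ⟨c₃, hc₃, U₀, hU₀, h'⟩ := h R hR2
  refine ⟨c₃, hc₃, U₀, hU₀, ?_⟩
  intro P c hP hc hc6 hc₃' μ hμ U hU hU9 hU₀' β hβmin hβc K hK L M _ _ hL3 hM3 d Kb D hd hKbN hD Qe hCE h0 cc n j hreg hj B W Z σ Φ ψ τ ι₁ ι₂ X hB hW hZ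
    hσ hΦ hψ hτ hι₁ hι₂ hX ρ Q' Q ĉ Y A A' ι₃ hρ hQ' hQ hĉ hY hA hA' hι₃ hblock amp1 amp2 himp₁ himp₂ hcell hstep hUdoor hcdoor
  have hx : 0 < imagTimeWeight β M := by
    unfold imagTimeWeight
    have hβ : 0 < β := KLRegimeSplit.pos_of_klBetaMin_le hβmin
    have : (0 : ℝ) < M := Nat.cast_pos.2 (Nat.pos_of_ne_zero (NeZero.ne M))
    positivity
  have hK0 : 0 ≤ P.Klam := le_trans zero_le_one hP.1
  have hB0 : 0 ≤ B := le_trans zero_le_one hB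
  have hεl : B * epsCoupling P U 0 ≤ B * epsCoupling P U j := mul_le_mul_of_nonneg_left (epsCoupling_zero_le_epsCoupling hK0 U j) hB0
  obtain ⟨⟨hQ'0, hQ0, hA0, _, _, _⟩, ⟨hF1, hF2, hF3, hF4, hF6, hF7⟩, ⟨hu₁, hu₂⟩, _, _⟩ :=
    towerLevNumerics_rows hW hZ hC₁ hC₂ hd hx hCE hB hι₂ hX hρ hQ' hQ hĉ hY hA hA' hι₃ hblock amp1 amp2
  obtain ⟨hx₁, hx₂, hx₃, hy, hθ, hclose⟩ :=
    towerLevNumerics_side_of_doors hK0 hσ hΦ hψ hτ hW hZ hC₁ hC₂ hd hx hCE hB hι₁ hι₂ hX hB0 hU.le hreg hj hρ hQ' hQ hĉ hY hA hA' hι₃ hblock amp1 amp2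
      hUdoor hcdoor
  exact h' P c hP hc hc6 hc₃' μ hμ U hU hU9 hU₀' β hβmin hβc K hK L M hL3 hM3 d Kb D hd hKbN hD Qe hCE h0 A (B * epsCoupling P U j) Q B hA0.le hQ0 hB hεl
    W Z A' Q' hW hZ hF1 hF2 hF3 hF4 hQ'0 σ Φ ψ τ ι₁ ι₂ ι₃ X hσ hΦ hψ hτ hF6 hF7 himp₁ himp₂ hcell hstep hx₁ hx₂ hx₃ hy hθ hu₁ hu₂ hclose

end Summit.HubbardSuperconductivity.HubbardSuperconductivity.Theorems.EngineV8

end
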